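import Summits.HubbardSuperconductivity.HubbardSuperconductivity.Theorems.AnisotropyChordTransferKreinJF1

/-!
# PartN28 — the PARALLEL-SUM INEQUALITY and the RANGE BOUND behind (CERT′) (memo ROTOR-THEORY-20 §263(h′), THEOREMS M89′)

The Λ_B-free form of the Hessian-free certificate splits the exact dressed shell operator as
`Q̃ = A_ε + M_ε`, `A_ε = Q_S + (1-ε) B P⁻¹ Bᴴ ≥ c_ε (ΔW)⁻¹`, `M_ε = ε B P⁻¹ Bᴴ ≥ 0`, and the shell residual as
`r̃ = r_S + B P⁻¹ d` with `B P⁻¹ d ∈ range M_ε`.  Two finite-dimensional facts then bound the penalty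
`⟨r̃, Q̃⁻¹ r̃⟩ ≤ ⟨r_S, A_ε⁻¹ r_S⟩ + ⟨d, P⁻¹ d⟩/ε`:

* `parallel_sum_bound` : for Hermitian `A, M ≥ 0` and `(A + M) x = A z + M y`,
  `Re⟨(A+M) x, x⟩ ≤ Re⟨z, A z⟩ + Re⟨y, M y⟩`  (i.e. `⟨v,(A+M)⁻¹ v⟩ ≤ ⟨a′,A⁻¹a′⟩ + ⟨y, M y⟩` for `v = a′ + M y`);
  proof: `0 ≤ ‖z − x‖²_A + ‖y − x‖²_M`.
* `range_factor_bound` : if `G w = ε • G (Gᴴ y)` with `ε > 0` (so `M_ε y = G w` for `M_ε = ε G Gᴴ`), then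
  `ε · ‖Gᴴ y‖² ≤ ‖w‖² / ε`, i.e. `⟨y, M_ε y⟩ ≤ ‖w‖²/ε`; proof: `0 ≤ ‖w − ε Gᴴ y‖²`.

In the application `G = B P^{-1/2}`, `w = P^{-1/2} d`, so `‖w‖² = ⟨d, P⁻¹ d⟩`.  Mathlib only; no `sorry`.
Theory seat hubbard-h0-rotor-theory-1, cycle 20.  Companion of PartN27 (`quadratic_lower_bound`,
`certificate_lower_bound`, `penalty_le_of_coercive`).
-/

-- Port of theory seat `hubbard-h0-rotor-theory-1` cycle20/lean/PartN28.lean (sha16 86dc1e7895005f1c) verbatim modulo this header,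
-- `set_option linter.dupNamespace false`, lint fixes, and `re_form_symm` replaced by the landed `JF1.re_dot_mulVec_symm` (dedup); prover seat `hubbard-h0-rotor-p1` g21, `--supports stmt-HubbardSuperconductivity-19089`.

set_option linter.dupNamespace false

namespace Summit.HubbardSuperconductivity.HubbardSuperconductivity.Theorems.AnisotropyChord.Transfer.ParallelSum

open Matrix
open scoped ComplexOrder

variable {m k : Type*} [Fintype m] [Fintype k]

/-- Expansion of `Re⟨p − x, Q (p − x)⟩` for Hermitian `Q`. -/
theorem re_form_sub (Q : Matrix m m ℂ) (hQ : Q.IsHermitian) (p x : m → ℂ) :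
    (star (p - x) ⬝ᵥ Q.mulVec (p - x)).re
      = (star p ⬝ᵥ Q.mulVec p).re - 2 * (star x ⬝ᵥ Q.mulVec p).re + (star x ⬝ᵥ Q.mulVec x).re := by
  have e : star (p - x) ⬝ᵥ Q.mulVec (p - x)
      = star p ⬝ᵥ Q.mulVec p - star p ⬝ᵥ Q.mulVec x - star x ⬝ᵥ Q.mulVec p + star x ⬝ᵥ Q.mulVec x := by
    rw [star_sub, Matrix.mulVec_sub, sub_dotProduct, dotProduct_sub, dotProduct_sub]; ring
  rw [e]; simp only [Complex.sub_re, Complex.add_re]; rw [JF1.re_dot_mulVec_symm Q hQ p x]; ring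

/-- **PARALLEL-SUM INEQUALITY.**  For Hermitian positive-semidefinite `A, M` and vectors with
`(A + M) x = A z + M y`:  `Re⟨(A + M) x, x⟩ ≤ Re⟨z, A z⟩ + Re⟨y, M y⟩`.  With `A` invertible and
`x = (A+M)⁻¹ v`, `v = A z + M y`, this reads `⟨v, (A+M)⁻¹ v⟩ ≤ ⟨A z, A⁻¹ (A z)⟩ + ⟨y, M y⟩`.
[memo ROTOR-THEORY-20 §263(h′); folklore (parallel sum / infimal convolution of quadratic forms)] -/
theorem parallel_sum_bound (A M : Matrix m m ℂ) (hA : A.PosSemidef) (hM : M.PosSemidef)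
    (x y z : m → ℂ) (hx : (A + M).mulVec x = A.mulVec z + M.mulVec y) :
    (star ((A + M).mulVec x) ⬝ᵥ x).re ≤ (star z ⬝ᵥ A.mulVec z).re + (star y ⬝ᵥ M.mulVec y).re := by
  have hAH : A.IsHermitian := hA.1
  have hMH : M.IsHermitian := hM.1
  have h1 : 0 ≤ (star (z - x) ⬝ᵥ A.mulVec (z - x)).re :=
    (Complex.nonneg_iff.mp (hA.dotProduct_mulVec_nonneg (z - x))).1
  have h2 : 0 ≤ (star (y - x) ⬝ᵥ M.mulVec (y - x)).re :=
    (Complex.nonneg_iff.mp (hM.dotProduct_mulVec_nonneg (y - x))).1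
  rw [re_form_sub A hAH z x] at h1
  rw [re_form_sub M hMH y x] at h2
  -- left side: Re⟨(A+M)x, x⟩ = Re⟨x, A x⟩ + Re⟨x, M x⟩
  have eL : (star ((A + M).mulVec x) ⬝ᵥ x).re
      = (star x ⬝ᵥ A.mulVec x).re + (star x ⬝ᵥ M.mulVec x).re := by
    have : star ((A + M).mulVec x) ⬝ᵥ x = star x ⬝ᵥ (A + M).mulVec x := by
      rw [Matrix.star_mulVec, (hAH.add hMH).eq, ← Matrix.dotProduct_mulVec]
    rw [this, Matrix.add_mulVec, dotProduct_add, Complex.add_re]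
  -- cross terms: Re⟨x, A z⟩ + Re⟨x, M y⟩ = Re⟨x, A x⟩ + Re⟨x, M x⟩
  have eX : (star x ⬝ᵥ A.mulVec z).re + (star x ⬝ᵥ M.mulVec y).re
      = (star x ⬝ᵥ A.mulVec x).re + (star x ⬝ᵥ M.mulVec x).re := by
    have e : star x ⬝ᵥ A.mulVec z + star x ⬝ᵥ M.mulVec y = star x ⬝ᵥ (A + M).mulVec x := by
      rw [← dotProduct_add, ← hx]
    have h := congrArg Complex.re e
    rw [Matrix.add_mulVec, dotProduct_add] at h
    simpa only [Complex.add_re] using h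
  rw [eL]
  linarith [h1, h2, eX]

/-- Nonnegativity of `Re⟨v, v⟩`. -/
theorem re_self_nonneg [DecidableEq k] (v : k → ℂ) : 0 ≤ (star v ⬝ᵥ v).re := by
  have h := (Matrix.PosDef.one : (1 : Matrix k k ℂ).PosDef).posSemidef.dotProduct_mulVec_nonneg v
  rw [Matrix.one_mulVec] at h
  exact (Complex.nonneg_iff.mp h).1

/-- **RANGE BOUND.**  If `G w = ε • G (Gᴴ y)` with `ε > 0` — i.e. `M_ε y = G w` for `M_ε := ε G Gᴴ` — then
`ε · Re⟨Gᴴ y, Gᴴ y⟩ ≤ Re⟨w, w⟩ / ε`, that is `⟨y, M_ε y⟩ ≤ ‖w‖²/ε`.  In (CERT′): `G = B P^{-1/2}`,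
`w = P^{-1/2} d`, giving `⟨y, M_ε y⟩ ≤ ⟨d, P⁻¹ d⟩/ε`.  Proof: `0 ≤ ‖w − ε Gᴴ y‖²`.
[memo ROTOR-THEORY-20 §263(h′); folklore] -/
theorem range_factor_bound [DecidableEq k] (G : Matrix m k ℂ) (y : m → ℂ) (w : k → ℂ) (ε : ℝ)
    (hε : 0 < ε) (h : G.mulVec w = (ε : ℂ) • G.mulVec (Gᴴ.mulVec y)) :
    ε * (star (Gᴴ.mulVec y) ⬝ᵥ Gᴴ.mulVec y).re ≤ (star w ⬝ᵥ w).re / ε := by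
  set u : k → ℂ := Gᴴ.mulVec y with hu
  -- key identity: ⟨w, u⟩ = ε ⟨u, u⟩
  have key : star w ⬝ᵥ u = (ε : ℂ) * (star u ⬝ᵥ u) := by
    have e1 : star w ⬝ᵥ u = star (G.mulVec w) ⬝ᵥ y := by
      rw [hu, Matrix.dotProduct_mulVec, Matrix.star_mulVec]
    have e2 : star (G.mulVec u) ⬝ᵥ y = star u ⬝ᵥ u := by
      rw [Matrix.star_mulVec, ← Matrix.dotProduct_mulVec]
    rw [e1, h, star_smul, Complex.star_def, Complex.conj_ofReal, smul_dotProduct, smul_eq_mul, e2]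
  have h0 : 0 ≤ (star (w - (ε : ℂ) • u) ⬝ᵥ (w - (ε : ℂ) • u)).re := re_self_nonneg _
  have e0 : star (w - (ε : ℂ) • u) ⬝ᵥ (w - (ε : ℂ) • u)
      = star w ⬝ᵥ w - (ε : ℂ) * (star w ⬝ᵥ u) - (ε : ℂ) * (star u ⬝ᵥ w)
        + ((ε * ε : ℝ) : ℂ) * (star u ⬝ᵥ u) := by
    have hs : star ((ε : ℂ) • u) = (ε : ℂ) • star u := by
      rw [star_smul, Complex.star_def, Complex.conj_ofReal]
    rw [star_sub, hs, sub_dotProduct, dotProduct_sub, dotProduct_sub]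
    simp only [smul_dotProduct, dotProduct_smul, smul_eq_mul]
    push_cast
    ring
  have euw : (star u ⬝ᵥ w).re = (star w ⬝ᵥ u).re := by
    have : star u ⬝ᵥ w = star (star w ⬝ᵥ u) := by
      rw [← Matrix.star_dotProduct_star, star_star]
    rw [this, Complex.star_def, Complex.conj_re]
  have hk : (star w ⬝ᵥ u).re = ε * (star u ⬝ᵥ u).re := by
    rw [key, Complex.re_ofReal_mul]
  have h1 : (star (w - (ε : ℂ) • u) ⬝ᵥ (w - (ε : ℂ) • u)).re
      = (star w ⬝ᵥ w).re - 2 * ε * (star w ⬝ᵥ u).re + ε * ε * (star u ⬝ᵥ u).re := by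
    rw [e0]; simp only [Complex.sub_re, Complex.add_re, Complex.re_ofReal_mul]; rw [euw]; ring
  rw [h1, hk] at h0
  -- h0 : 0 ≤ ‖w‖² − 2ε·ε‖u‖² + ε²‖u‖² = ‖w‖² − ε²‖u‖²
  rw [le_div_iff₀ hε]
  have huu : 0 ≤ (star u ⬝ᵥ u).re := re_self_nonneg u
  nlinarith [h0, huu, hε]

omit [Fintype m] in
/-- **(CERT′) assembled abstractly.**  If the penalty splits as in the two lemmas above —
`Re⟨r̃, y⟩ ≤ pA + pM` with `pA` the `A_ε`-part and `pM ≤ ⟨d,P⁻¹d⟩/ε` the range part — and the trial value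
obeys `g + bonus ≤ F(τ)` with `bonus = ⟨d, P⁻¹ d⟩ ≥ 0`, then `g + bonus − pA − pM` is a lower bound for
`F` everywhere (hence for `3V²Φ = min F`).  Pure bookkeeping on top of PartN27's `quadratic_lower_bound`;
stated here so that the port carries the exact shape used in memo §263(h′). -/
theorem certificate_prime (F : (m → ℂ) → ℝ) (τ : m → ℂ) (g bonus pen pA pM : ℝ)
    (hquad : ∀ τ', F τ - pen ≤ F τ') (hg : g + bonus ≤ F τ) (hsplit : pen ≤ pA + pM) :
    ∀ τ', g + bonus - pA - pM ≤ F τ' := by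
  intro τ'
  have := hquad τ'
  linarith

end Summit.HubbardSuperconductivity.HubbardSuperconductivity.Theorems.AnisotropyChord.Transfer.ParallelSum
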